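import Literature.Algebra.EuclideanLattices.MRFineGridChoice
import Literature.Algebra.EuclideanLattices.MRIncGDDIdealised
import Literature.Computability.Cryptography.SISOracleKernel
import Mathlib.Data.List.ProdSigma
import HarnessLib

/-!
# The idealised `IncGDD` solver of Micciancio–Regev 2007 (Thm. 5.9): attempts with verification over all guesses, and its failure probability — proved

Topic `Algebra/EuclideanLattices` (family `pqc`). Builds the SOLVER out of the one-guess experiment of
`MRIncGDDIdealised.lean`: for an `IncGDD` instance `(Λ, S, t, r)` (full-rank lattice `Λ`, `n`
linearly independent lattice vectors `S`, target `t`, radius `r`) and an oracle kernel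
`O : ℤ_q^{n×m} → PMF ℤᵐ`, one ATTEMPT runs the idealised reduction for a guess `(j₀, α)` on the fine
grid chosen from the data (`MRFineGridChoice.lean`: `bⱼ = sⱼ/(q d)` with `d • Λ ⊆ L(S)`) and keeps the
output only if it verifies (`s ∈ Λ`, `‖s − t‖ ≤ R`); the solver runs one independent attempt per guess
`(j, α) ∈ [m] × {±1, …, ±⌊β⌋}` and returns the first verified answer. Everything is a `PMF`; no
machine. Main result (`toReal_solve_none_le`): with `R = n√m β σ/q + r` (`‖sⱼ‖ ≤ σ`), the promise
`2r/(β√n) ≥ 2η_ε(Λ)`, `β ≥ 1`, `0 < ε < 1` and the side condition of Thm. 5.9,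

  `Pr[solver fails] ≤ 1 − (δ/(2βm) − m · 2ε/(1+ε))/3`,

`δ = Pr_{A ∼ U, z ∼ O(A)}[IsSolution A β z]` the kernel's average-case `SIS_{q,m,β}` success
(`SISOracleKernel.successProb_eq_toReal_bind` for a `RandAlg`). Ingredients: the kernel form of the
guessing step (`exists_guess_kernel`, MR07 p. 23 "`δ_{j′,α′} ≥ δ/2βm`"), the attempt bound
(`toReal_attempt_none_le` = `toReal_experiment_success_ge` read through the verification), and
independence (`solve_none_le`).

* Definitions (with bodies): `guessShift` (the shifts `tᵢ` of a guess), `attempt`, `solve`, `boxList`,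
  `guessList`.
* `norm_sub_le_of_mem_support_attempt/solve` — verified answers are within `R` of the target.

## References

* D. Micciancio, O. Regev, *Worst-case to average-case reductions based on Gaussian measures*,
  SIAM J. Comput. 37 (2007) 267–302; authors' version (`lit read doi:10.1137/S0097539705447360`),
  Thm. 5.9 and its proof (pp. 22–24), Def. 5.6 (`IncGDD`, p. 19).
-/

noncomputable section

open Finset Module Submodule

namespace Literature.Algebra.EuclideanLattices

namespace MicciancioRegev2007

/-! ## The idealised `IncGDD` solver: attempts with verification, all guesses, and its failure probability -/

section Solver

open scoped ENNReal Classical Real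
open MeasureTheory PMF Literature.Probability.Distributions Literature.Computability.Cryptography
  Literature.Computability.Cryptography.SIS

variable {V : Type*} [NormedAddCommGroup V] [InnerProductSpace ℝ V] [FiniteDimensional ℝ V]
  [MeasurableSpace V] [BorelSpace V]
variable (Λ : Submodule ℤ V) [DiscreteTopology Λ] [IsZLattice ℝ Λ]
variable {n : ℕ} (S : Fin n → Λ) (hS : LinearIndependent ℝ fun j => (S j : V)) (hn : n = finrank ℝ V)
variable (q d : ℕ) [NeZero q] [NeZero d]
variable {m : ℕ} (O : Matrix (Fin n) (Fin m) (ZMod q) → PMF (Fin m → ℤ))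

/-! ### A support lemma for independent products -/

/-- A tuple in the support of an independent product has each coordinate in the support of its law.
[folklore] -/
theorem mem_support_of_mem_support_indepLaw {α : Type*} {K : ℕ} {p : Fin K → PMF α} {v : Fin K → α}
    (hv : v ∈ (indepLaw K p).support) (k : Fin K) : v k ∈ (p k).support := by
  rw [PMF.mem_support_iff, indepLaw_apply] at hv
  exact (PMF.mem_support_iff _ _).2 ((Finset.prod_ne_zero_iff.1 hv) k (Finset.mem_univ k))

/-! ### The shifts of a guess -/

/-- **The shifts `tᵢ` for the guess `(j₀, α)`** (MR07 Thm. 5.9, step 1: "`tᵢ = −t/α` if `i = j`,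
`0` otherwise"). [cite: MicciancioRegev2007, Thm. 5.9 (proof, step 1, p. 22)] -/
def guessShift (t : V) (j₀ : Fin m) (α : ℤ) : Fin m → V :=
  fun i => if i = j₀ then (-((α : ℝ)⁻¹)) • t else 0

omit [FiniteDimensional ℝ V] [MeasurableSpace V] [BorelSpace V] in
/-- `T z = −t` when `z_{j₀} = α ≠ 0` (p. 23: "if we define `T = [t₁, …, t_m]`, we get `Tz = −t`").
[cite: MicciancioRegev2007, Thm. 5.9 (proof, p. 23)] -/
theorem sum_smul_guessShift (t : V) (j₀ : Fin m) {α : ℤ} (hα : α ≠ 0)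
    (z : Fin m → ℤ) (hz : z j₀ = α) : ∑ i, (z i : ℝ) • guessShift t j₀ α i = -t := by
  rw [Finset.sum_eq_single j₀]
  · rw [guessShift, if_pos rfl, hz, smul_smul, mul_neg, mul_inv_cancel₀ (by exact_mod_cast hα),
      neg_one_smul]
  · intro i _ hi
    rw [guessShift, if_neg hi, smul_zero]
  · exact fun h => (h (Finset.mem_univ _)).elim

/-! ### Reading a verified-output map -/

/-- For a law post-processed by "keep the value if it verifies": `Pr[none] = 1 − Pr[verifies]`.
[folklore] -/
theorem toReal_map_dite_none {Ω γ : Type*} (E : PMF Ω) (P : Ω → Prop) [DecidablePred P]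
    (g : ∀ ω, P ω → γ) :
    ((E.map fun ω => if h : P ω then some (g ω h) else none) none).toReal =
      1 - (E.toOuterMeasure {ω | P ω}).toReal := by
  rw [← PMF.toOuterMeasure_apply_singleton, PMF.toOuterMeasure_map_apply]
  have hpre : (fun ω => if h : P ω then some (g ω h) else none) ⁻¹' {none} = {ω | P ω}ᶜ := by
    ext ω
    simp only [Set.mem_preimage, Set.mem_singleton_iff, Set.mem_compl_iff, Set.mem_setOf_eq]
    split_ifs with h <;> simp [h]
  rw [hpre, toReal_toOuterMeasure_compl]

/-- On the support of a verified-output map, a kept value verifies. [folklore] -/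
theorem exists_of_some_mem_support_map_dite {Ω γ : Type*} (E : PMF Ω) (P : Ω → Prop) [DecidablePred P]
    (g : ∀ ω, P ω → γ) {u : γ}
    (hu : some u ∈ (E.map fun ω => if h : P ω then some (g ω h) else none).support) :
    ∃ ω, ∃ h : P ω, g ω h = u := by
  rw [PMF.support_map] at hu
  obtain ⟨ω, -, hω⟩ := hu
  dsimp only at hω
  split_ifs at hω with h
  · exact ⟨ω, h, Option.some_injective _ hω⟩

/-! ### One attempt: the experiment for a guess, with verification -/

/-- **One attempt of the idealised reduction for the guess `(j₀, α)`**, on the fine grid chosen from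
`(Λ, S, q, d)` (`MRFineGridChoice`): run `experiment` with Gaussian parameter `s = 2r/(β√n)` and the
shifts of the guess, read the output `s = x − Yz`, and keep it iff it VERIFIES as an `IncGDD` answer
(`s ∈ Λ` and `‖s − t‖ ≤ R`) — solutions of `IncGDD` are checkable, so a wrong guess costs nothing.
[cite: MicciancioRegev2007, Thm. 5.9 (the reduction, p. 22) with Def. 5.6 (IncGDD)] -/
def attempt (t : V) (r R β : ℝ) (j₀ : Fin m) (α : ℤ) : PMF (Option Λ) :=
  (experiment (gridBasis Λ S hS hn (q * d)) q d Λ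
      (Function.surjInv (gridClass_surjective (gridBasis Λ S hS hn (q * d)) (q * d) Λ))
      (smul_gridBasis_mem Λ S hS hn (q * d)) (Function.surjInv_eq _) O
      (2 * r / (β * Real.sqrt (finrank ℝ V))) (guessShift t j₀ α)).map
    fun ω =>
      if h : output (gridBasis Λ S hS hn (q * d)) q d Λ
            (Function.surjInv (gridClass_surjective (gridBasis Λ S hS hn (q * d)) (q * d) Λ)) ω ∈ Λ ∧
          ‖output (gridBasis Λ S hS hn (q * d)) q d Λ
              (Function.surjInv (gridClass_surjective (gridBasis Λ S hS hn (q * d)) (q * d) Λ)) ω - t‖ ≤ R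
      then some ⟨_, h.1⟩ else none

omit [MeasurableSpace V] [BorelSpace V] [IsZLattice ℝ Λ] in
/-- A verified output of an attempt is within `R` of the target. [folklore] -/
theorem norm_sub_le_of_mem_support_attempt (t : V) (r R β : ℝ) (j₀ : Fin m) (α : ℤ) {u : Λ}
    (hu : some u ∈ (attempt Λ S hS hn q d O t r R β j₀ α).support) : ‖(u : V) - t‖ ≤ R := by
  obtain ⟨ω, h, rfl⟩ := exists_of_some_mem_support_map_dite _ _ _ hu
  exact h.2

/-- **The failure probability of one attempt** (MR07 Thm. 5.9 for the idealised reduction,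
`MRIncGDDIdealised.toReal_experiment_success_ge`, read through the verification): with the
verification radius `R = n√m β σ/q + r` (`‖sⱼ‖ ≤ σ`), `s = 2r/(β√n) ≥ 2η_ε(Λ)`, `d • Λ ⊆ L(S)`, and the
side condition, `Pr[attempt fails] ≤ 1 − (δ_{j₀,α} − m·2ε/(1+ε))/3`.
[cite: MicciancioRegev2007, Thm. 5.9 (proof, pp. 22–24)] -/
theorem toReal_attempt_none_le (hd : ∀ x : Λ, d • x ∈ span ℤ (Set.range S)) {ε β r σ : ℝ}
    (hε : 0 < ε) (hε1 : ε < 1) (hβ : 0 < β) (hr : 0 < r) (hn1 : 1 ≤ finrank ℝ V)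
    (hηs : 2 * smoothingParameter Λ ε ≤ 2 * r / (β * Real.sqrt (finrank ℝ V)))
    (hσ : ∀ j, ‖(S j : V)‖ ≤ σ) (t : V) (j₀ : Fin m) {α : ℤ} (hα : α ≠ 0)
    (hnum : 1 / (2 * π) + ε / (1 - ε) + (ε / (1 - ε)) ^ 2 * m ≤ 1 / 6) :
    ((attempt Λ S hS hn q d O t r (n * Real.sqrt m * β * σ / q + r) β j₀ α) none).toReal ≤
      1 - (1 / 3 : ℝ) *
        ((((PMF.uniformOfFintype (Matrix (Fin n) (Fin m) (ZMod q))).bind fun A =>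
            (O A).map (Prod.mk A)).toOuterMeasure
            {az | az.1.mulVec (fun i => (az.2 i : ZMod q)) = 0 ∧ ∑ i, (az.2 i : ℝ) ^ 2 ≤ β ^ 2 ∧
              az.2 j₀ = α}).toReal - m * (2 * ε / (1 + ε))) := by
  set b := gridBasis Λ S hS hn (q * d) with hb
  set rep := Function.surjInv (gridClass_surjective b (q * d) Λ) with hrep_def
  have hσ' : ∀ j, ‖((q * d : ℕ) : ℝ) • b j‖ ≤ σ := fun j => by rw [hb, smul_gridBasis]; exact hσ j
  have hmain := toReal_experiment_success_ge b q d Λ rep (smul_gridBasis_mem Λ S hS hn (q * d))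
    (Function.surjInv_eq _) (le_span_gridBasis Λ S hS hn q d hd) O hε hε1 hβ hr hn1 hηs hσ'
    (guessShift t j₀ α) t j₀ α (fun z hz => sum_smul_guessShift t j₀ hα z hz) hnum
  -- the `none` mass is one minus the mass of the verified-success event
  rw [attempt, toReal_map_dite_none]
  linarith

/-! ### All guesses: independent attempts, first verified success -/

/-- **The idealised `IncGDD` solver**: one independent attempt per guess in the list `gs`, output the
first verified success (MR07 picks the guess at random; since `IncGDD` answers are verifiable, trying
all `2⌊β⌋m` guesses only improves the success probability). [cite: MicciancioRegev2007, Thm. 5.9 (proof, p. 23: "the event j = j′, α = α′ happens with probability 1/2βm")] -/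
def solve (t : V) (r R β : ℝ) (gs : List (Fin m × ℤ)) : PMF (Option Λ) :=
  (indepLaw gs.length fun k => attempt Λ S hS hn q d O t r R β (gs.get k).1 (gs.get k).2).map
    fun v => (List.ofFn v).findSome? id

omit [MeasurableSpace V] [BorelSpace V] [IsZLattice ℝ Λ] in
/-- A verified output of the solver is within `R` of the target. [folklore] -/
theorem norm_sub_le_of_mem_support_solve (t : V) (r R β : ℝ) (gs : List (Fin m × ℤ)) {u : Λ}
    (hu : some u ∈ (solve Λ S hS hn q d O t r R β gs).support) : ‖(u : V) - t‖ ≤ R := by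
  rw [solve, PMF.support_map] at hu
  obtain ⟨v, hv, hvu⟩ := hu
  obtain ⟨o, ho, hou⟩ := List.exists_of_findSome?_eq_some hvu
  rw [List.mem_ofFn] at ho
  obtain ⟨k, rfl⟩ := ho
  simp only [id] at hou
  have hk : v k ∈ (attempt Λ S hS hn q d O t r R β (gs.get k).1 (gs.get k).2).support :=
    mem_support_of_mem_support_indepLaw hv k
  rw [hou] at hk
  exact norm_sub_le_of_mem_support_attempt Λ S hS hn q d O t r R β _ _ hk

omit [MeasurableSpace V] [BorelSpace V] [IsZLattice ℝ Λ] in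
/-- **The solver fails at most as often as any single one of its attempts** (independence: the
failure event is the product of the per-guess failure events). [folklore] -/
theorem solve_none_le (t : V) (r R β : ℝ) (gs : List (Fin m × ℤ)) (k : Fin gs.length) :
    (solve Λ S hS hn q d O t r R β gs) none ≤
      (attempt Λ S hS hn q d O t r R β (gs.get k).1 (gs.get k).2) none := by
  rw [← PMF.toOuterMeasure_apply_singleton, solve, PMF.toOuterMeasure_map_apply]
  have hset : (fun v : Fin gs.length → Option Λ => (List.ofFn v).findSome? id) ⁻¹' {none} =
      {v | ∀ k, v k ∈ ({none} : Set (Option Λ))} := by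
    ext v
    simp only [Set.mem_preimage, Set.mem_singleton_iff, List.findSome?_eq_none_iff, List.mem_ofFn,
      id, Set.mem_setOf_eq, forall_exists_index]
    exact ⟨fun h k => h (v k) k rfl, fun h o k hk => hk ▸ h k⟩
  rw [hset, toOuterMeasure_indepLaw_pi, ← Finset.mul_prod_erase Finset.univ _ (Finset.mem_univ k),
    PMF.toOuterMeasure_apply_singleton]
  refine (mul_le_mul' le_rfl (Finset.prod_le_one (fun i _ => zero_le) fun i _ => ?_)).trans
    (le_of_eq (mul_one _))
  exact ((PMF.toOuterMeasure_mono _ (Set.subset_univ _)).trans_eq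
    ((PMF.toOuterMeasure_apply_eq_one_iff _ _).2 (Set.subset_univ _)))

/-! ### The guesses -/

/-- The box `B = {−T, …, −1, 1, …, T}` as a list. [cite: MicciancioRegev2007, Thm. 5.9 (proof, step 1: B = {−β,…,−1,1,…,β})] -/
def boxList (T : ℕ) : List ℤ :=
  (List.range T).map (fun i : ℕ => (i : ℤ) + 1) ++ (List.range T).map (fun i : ℕ => -((i : ℤ) + 1))

/-- Membership in the box: `a ∈ B ↔ a ≠ 0 ∧ |a| ≤ T`. [folklore] -/
theorem mem_boxList {T : ℕ} {a : ℤ} : a ∈ boxList T ↔ a ≠ 0 ∧ |a| ≤ T := by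
  constructor
  · intro ha
    rcases List.mem_append.1 ha with h | h
    · obtain ⟨i, hi, rfl⟩ := List.mem_map.1 h
      have hi' : (i : ℤ) < T := by exact_mod_cast List.mem_range.1 hi
      refine ⟨by omega, ?_⟩
      rw [abs_of_nonneg (by omega)]
      omega
    · obtain ⟨i, hi, rfl⟩ := List.mem_map.1 h
      have hi' : (i : ℤ) < T := by exact_mod_cast List.mem_range.1 hi
      refine ⟨by omega, ?_⟩
      rw [abs_of_nonpos (by omega)]
      omega
  · rintro ⟨h0, hT⟩
    obtain ⟨hT1, hT2⟩ := abs_le.1 hT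
    rw [boxList, List.mem_append, List.mem_map, List.mem_map]
    rcases lt_or_gt_of_ne h0 with hneg | hpos
    · right
      have hc : (((-a - 1).toNat : ℕ) : ℤ) = -a - 1 := Int.toNat_of_nonneg (by omega)
      refine ⟨(-a - 1).toNat, List.mem_range.2 ?_, by omega⟩
      have : (((-a - 1).toNat : ℕ) : ℤ) < T := by omega
      exact_mod_cast this
    · left
      have hc : (((a - 1).toNat : ℕ) : ℤ) = a - 1 := Int.toNat_of_nonneg (by omega)
      refine ⟨(a - 1).toNat, List.mem_range.2 ?_, by omega⟩
      have : (((a - 1).toNat : ℕ) : ℤ) < T := by omega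
      exact_mod_cast this

/-- **All guesses** `(j, α) ∈ [m] × B`. [cite: MicciancioRegev2007, Thm. 5.9 (proof, step 1)] -/
def guessList (m T : ℕ) : List (Fin m × ℤ) :=
  List.finRange m ×ˢ boxList T

/-- Membership in the guess list. [folklore] -/
theorem mem_guessList {m T : ℕ} {j : Fin m} {a : ℤ} : (j, a) ∈ guessList m T ↔ a ≠ 0 ∧ |a| ≤ T := by
  rw [guessList, List.mem_product, mem_boxList]
  simp

/-! ### The guessing step in kernel form -/

/-- **MR07 Thm. 5.9, the guessing step, for an oracle kernel** (p. 23: "`∑_{j′,α′} δ_{j′,α′} ≥ δ`.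
Hence there must exist some `j′, α′` for which `δ_{j′,α′} ≥ δ/2βm`"): under `A ∼ U(ℤ_q^{n×m})`,
`z ∼ O(A)`, some guess `(j, a)`, `a ≠ 0`, `|a| ≤ ⌊β⌋`, has
`Pr[IsSolution A β z ∧ z_j = a] ≥ Pr[IsSolution A β z] / (2βm)`.
[cite: MicciancioRegev2007, Thm. 5.9 (proof, p. 23)] -/
theorem exists_guess_kernel {β : ℝ} (hβ : 1 ≤ β) (hm : 0 < m) :
    ∃ j : Fin m, ∃ a : ℤ, a ≠ 0 ∧ |a| ≤ (⌊β⌋₊ : ℤ) ∧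
      (((PMF.uniformOfFintype (Matrix (Fin n) (Fin m) (ZMod q))).bind fun A =>
          (O A).map (Prod.mk A)).toOuterMeasure {az | IsSolution az.1 β az.2}).toReal / (2 * β * m) ≤
        (((PMF.uniformOfFintype (Matrix (Fin n) (Fin m) (ZMod q))).bind fun A =>
          (O A).map (Prod.mk A)).toOuterMeasure {az | IsSolution az.1 β az.2 ∧ az.2 j = a}).toReal := by
  set P := (PMF.uniformOfFintype (Matrix (Fin n) (Fin m) (ZMod q))).bind fun A => (O A).map (Prod.mk A)
    with hP
  set T : ℕ := ⌊β⌋₊ with hT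
  have hT1 : 1 ≤ T := Nat.le_floor (by exact_mod_cast hβ)
  have hTβ : (T : ℝ) ≤ β := Nat.floor_le (by linarith)
  set K : Finset (Fin m × ℤ) := Finset.univ ×ˢ ((Finset.Icc (-(T : ℤ)) T).erase 0) with hK
  have hKcard : (K.card : ℝ) = 2 * T * m := by
    rw [hK, Finset.card_product, Finset.card_univ, Fintype.card_fin, card_Icc_erase_zero]
    push_cast; ring
  have hKpos : (0 : ℝ) < K.card := by
    rw [hKcard]
    have : (0 : ℝ) < m := by exact_mod_cast hm
    have : (1 : ℝ) ≤ T := by exact_mod_cast hT1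
    positivity
  have hKne : K.Nonempty := by
    rw [← Finset.card_pos]; exact_mod_cast hKpos
  have hcover : {az : Matrix (Fin n) (Fin m) (ZMod q) × (Fin m → ℤ) | IsSolution az.1 β az.2} ⊆
      ⋃ k ∈ K, {az | IsSolution az.1 β az.2 ∧ az.2 k.1 = k.2} := by
    intro az haz
    obtain ⟨j, hj0, hjβ⟩ := exists_coord_ne_zero_abs_le haz.1 haz.2.2
    simp only [Set.mem_iUnion, Set.mem_setOf_eq, exists_prop]
    refine ⟨(j, az.2 j), ?_, haz, rfl⟩
    rw [hK, Finset.mem_product, Finset.mem_erase, Finset.mem_Icc]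
    refine ⟨Finset.mem_univ _, hj0, ?_⟩
    have habs : |az.2 j| ≤ (T : ℤ) := by
      have h1 : ((|az.2 j| : ℤ) : ℝ) ≤ β := by push_cast; exact hjβ
      have h2 : |az.2 j| ≤ ⌊β⌋ := Int.le_floor.2 h1
      rwa [← Int.natCast_floor_eq_floor (by linarith : (0 : ℝ) ≤ β)] at h2
    exact abs_le.1 habs
  have hsum : (P.toOuterMeasure {az | IsSolution az.1 β az.2}).toReal ≤
      ∑ k ∈ K, (P.toOuterMeasure {az | IsSolution az.1 β az.2 ∧ az.2 k.1 = k.2}).toReal :=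
    (ENNReal.toReal_mono (PMF.toOuterMeasure_ne_top _ _)
      (PMF.toOuterMeasure_mono _ (Set.inter_subset_left.trans hcover))).trans
      (PMF.toReal_toOuterMeasure_biUnion_finset_le _ K _)
  set δ : ℝ := (P.toOuterMeasure {az | IsSolution az.1 β az.2}).toReal with hδ
  have hδ0 : 0 ≤ δ := ENNReal.toReal_nonneg
  have hconst : ∑ _k ∈ K, δ / K.card = δ := by
    rw [Finset.sum_const, nsmul_eq_mul, mul_div_cancel₀ _ hKpos.ne']
  obtain ⟨⟨j, a⟩, hk, hle⟩ := Finset.exists_le_of_sum_le hKne (hconst.trans_le hsum)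
  rw [hK, Finset.mem_product, Finset.mem_erase, Finset.mem_Icc] at hk
  refine ⟨j, a, hk.2.1, abs_le.2 hk.2.2, le_trans ?_ hle⟩
  have hm' : (0 : ℝ) ≤ (m : ℝ) := Nat.cast_nonneg m
  exact div_le_div_of_nonneg_left hδ0 hKpos (by rw [hKcard]; nlinarith [hTβ, hm'])

/-! ### The failure probability of the solver -/

/-- **The idealised `IncGDD` solver succeeds with probability at least
`(δ/(2βm) − m·2ε/(1+ε))/3`** on instances satisfying the promise. Here
`δ = Pr_{A ∼ U, z ∼ O(A)}[IsSolution A β z]` is the oracle's average-case `SIS` success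
(`SISOracleKernel.successProb_eq_toReal_bind`), the verification radius is `n√m β σ/q + r`
(`‖sⱼ‖ ≤ σ`), and the promise is `s = 2r/(β√n) ≥ 2η_ε(Λ)`. Assembled from the guessing step, the
attempt bound for the good guess, and `solve_none_le`. [cite: MicciancioRegev2007, Thm. 5.9 (statement and proof, pp. 22–24)] -/
theorem toReal_solve_none_le (hd : ∀ x : Λ, d • x ∈ span ℤ (Set.range S)) {ε β r σ : ℝ}
    (hε : 0 < ε) (hε1 : ε < 1) (hβ : 1 ≤ β) (hr : 0 < r) (hn1 : 1 ≤ finrank ℝ V) (hm : 0 < m)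
    (hηs : 2 * smoothingParameter Λ ε ≤ 2 * r / (β * Real.sqrt (finrank ℝ V)))
    (hσ : ∀ j, ‖(S j : V)‖ ≤ σ) (t : V)
    (hnum : 1 / (2 * π) + ε / (1 - ε) + (ε / (1 - ε)) ^ 2 * m ≤ 1 / 6) :
    ((solve Λ S hS hn q d O t r (n * Real.sqrt m * β * σ / q + r) β (guessList m ⌊β⌋₊)) none).toReal ≤
      1 - (1 / 3 : ℝ) *
        ((((PMF.uniformOfFintype (Matrix (Fin n) (Fin m) (ZMod q))).bind fun A =>
            (O A).map (Prod.mk A)).toOuterMeasure {az | IsSolution az.1 β az.2}).toReal / (2 * β * m) -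
          m * (2 * ε / (1 + ε))) := by
  have hβ0 : 0 < β := by linarith
  obtain ⟨j, a, ha0, haT, hδ⟩ := exists_guess_kernel q O hβ hm
  -- the good guess is in the list
  have hmem : (j, a) ∈ guessList m ⌊β⌋₊ := mem_guessList.2 ⟨ha0, haT⟩
  obtain ⟨k, hk⟩ := List.get_of_mem hmem
  -- the solver fails at most as often as the attempt for the good guess
  have h1 : ((solve Λ S hS hn q d O t r (n * Real.sqrt m * β * σ / q + r) β (guessList m ⌊β⌋₊)) none).toReal ≤
      ((attempt Λ S hS hn q d O t r (n * Real.sqrt m * β * σ / q + r) β j a) none).toReal := by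
    have h := solve_none_le Λ S hS hn q d O t r (n * Real.sqrt m * β * σ / q + r) β (guessList m ⌊β⌋₊) k
    rw [hk] at h
    exact ENNReal.toReal_mono (PMF.apply_ne_top _ _) h
  refine h1.trans ((toReal_attempt_none_le Λ S hS hn q d O hd hε hε1 hβ0 hr hn1 hηs hσ t j ha0 hnum).trans ?_)
  -- the event of the attempt bound contains `IsSolution ∧ z_j = a`
  have hmono : (((PMF.uniformOfFintype (Matrix (Fin n) (Fin m) (ZMod q))).bind fun A =>
      (O A).map (Prod.mk A)).toOuterMeasure {az | IsSolution az.1 β az.2 ∧ az.2 j = a}).toReal ≤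
      (((PMF.uniformOfFintype (Matrix (Fin n) (Fin m) (ZMod q))).bind fun A =>
        (O A).map (Prod.mk A)).toOuterMeasure
        {az | az.1.mulVec (fun i => (az.2 i : ZMod q)) = 0 ∧ ∑ i, (az.2 i : ℝ) ^ 2 ≤ β ^ 2 ∧
          az.2 j = a}).toReal :=
    ENNReal.toReal_mono (PMF.toOuterMeasure_ne_top _ _) (PMF.toOuterMeasure_mono _
      (Set.inter_subset_left.trans fun az haz => mulVec_eq_zero_and_of_isSolution haz.1 haz.2))
  nlinarith [hmono, hδ]

end Solver

end MicciancioRegev2007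

end Literature.Algebra.EuclideanLattices

end
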